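import Summits.QuantumFields.BalabanUV.T4Continuum.Support.NE7EffectiveFormFlatSpectralGap
import Summits.QuantumFields.BalabanUV.T4Continuum.Support.NE7MinActHessianFlatCurl
import HarnessLib

/-!
# NE7GaugeFixedHessianNearFlat — THE FLAT DATUM IS A NON-DEGENERATE CRITICAL POINT OF THE GAUGE-FIXED `(j+1)`-STEP EFFECTIVE ACTION MODULO CONSTANTS: IN A NEIGHBOURHOOD OF THE FLAT
# DATUM THE GAUGE-FIXED HESSIAN (flat chart) HAS SPECTRAL GAP `≥ 1∕(N(N−1))` ON MEAN-ZERO DIRECTIONS (`d = 4`, every level `j`, every `U(n)`)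

Lineage `b2b-balaban-t4-ne7-p1` (CRUX PROVER NE7 #1 = OWNER of BINDER row NE7), generation 116; ROAD-G116 §6 (first, qualitative step towards (G) «non-flat data»).  Over
✓ `NE7EffectiveFormFlatSpectralGap.effectiveForm_add_divSq_ge_meanZero_flat_allLevels` (gap `2∕(N(N−1))` AT the flat datum) and the `C²`-smoothness of `m_{j+1} := minAct_{j+1} ∘ chart_1` at `0`
(✓ `NE7MinActHessianFlatCurl.minAct_hessian_flat_curl`, first conjunct) — `y ↦ D²m_{j+1}(y)` is continuous at `0` (`ContDiffAt.fderiv_right` twice), so the gap survives, halved, on a neighbourhood.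
WHAT ([folklore]; 0 def, 0 sorry):
* `norm_sq_le_card_mul_sum_nhsNormSq` — the parameter-space norm of `v ∈ skewSub 4 n N` against the `ℓ²(HS∕n)` sum of `ṽ` over the period box: `‖v‖² ≤ card n · Σ_x Σ_ν nhsNormSq(ṽ(x)_ν)`.
* `hessian_quadratic_near` — `C²` at `0` ⇒ eventually `|D²M(y)[v,v] − D²M(0)[v,v]| ≤ η·‖v‖²` (via `iteratedFDeriv ℝ 2`, whose operator norm is available).
* **`gaugeFixed_hessian_gap_near_flat_allLevels`** (`L ≥ 2`): `∃ ε₀ > 0 ∀ 0 < ε ≤ ε₀ ∀ m j, ∀ᶠ y in 𝓝 0, ∀ v ∈ skewSub 4 n (m+1)` with `Σ_{z ∈ box} ṽ(z)_ν = 0` for every `ν`: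
  `Σ_x Σ_ν nhsNormSq(ṽ(x)_ν) ≤ m(m+1) · (D²m_{j+1}(y)[v, v] + Σ_x nhsNormSq(Σ_μ (ṽ(x)_μ − ṽ(x−e_μ)_μ)))` — at every datum `chart_1(y)` NEAR the flat one the Hessian (in the flat chart) of the
  gauge-fixed effective action is positive definite on mean-zero directions, gap `1∕(N(N−1))` (`N = m+1`).
HONEST FRAMING: the neighbourhood is EXISTENTIAL (continuity; it depends on `n`, `L`, `N`, `j`, `ε` — NOT a uniform statement, NOT Bałaban's stability of the quadratic form under small background
fields, whose k-uniform form needs a curved commutation letter with gradient-type errors — ROAD-G116 §6 (G)); Hessian in the FLAT chart (not the intrinsic bordered Hessian of ✓ p828683 at the moving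
datum); OUR minimisers (B11 (8) with `sfClass`); nothing of Bałaban's asserted; NOT NE7 as a spine node; spine 0∕9; NOT infinite volume, NOT mass gap, NOT BetaPertH, NOT Clay.
-/

set_option autoImplicit false

open scoped BigOperators Matrix Matrix.Norms.L2Operator Topology
open NormedSpace Finset Filter

namespace Summit.QuantumFields.BalabanUV.T4Continuum.NE7GaugeFixedHessianNearFlat

open Literature.MathematicalPhysics.QuantumFieldTheory.Balaban1983to89
open B7Prop1Explicit B7Prop2Explicit
open T4AveragingDeficitWallBoundary (periodBox)
open AveragingDeficitTorusChart (TDir chart chartDir redN redN_boxVec)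
open AveragingDeficitTwoLevelPrep (skewSub)
open MinimalActionSandwich (minAct)
open MinimalActionRate (sfClass)
open MinimalActionWitness (flatCfg)
open MatrixNorms (nhsNormSq nhsNormSq_nonneg opNorm_sq_le_card_mul_nhsNormSq)
open NE7MinActHessianFlatCurl (minAct_hessian_flat_curl)
open NE7EffectiveFormFlatSpectralGap (effectiveForm_add_divSq_ge_meanZero_flat_allLevels)
open NE7BoxPoincareMatrix (boxVec_mem_periodBox)

noncomputable section

variable {n : Type} [Fintype n] [DecidableEq n]

/-- **The parameter norm against the `ℓ²(HS∕n)` energy**: `‖v‖² ≤ card n · Σ_{x ∈ [0,N)^4} Σ_ν nhsNormSq (ṽ(x)_ν)` for `v ∈ skewSub 4 n N` (sup of operator norms over the torus bonds versus the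
sum of normalised Hilbert–Schmidt squares over one period). [folklore] -/
theorem norm_sq_le_card_mul_sum_nhsNormSq {N : ℕ} [NeZero N] (v : ↥(skewSub 4 n N)) :
    ‖v‖ ^ 2 ≤ (Fintype.card n : ℝ) * ∑ x ∈ periodBox N, ∑ ν : Fin 4, nhsNormSq (chartDir (ContinuousLinearMap.id ℝ (Matrix n n ℂ)) N (v : TDir 4 n N) x ν) := by
  set S : ℝ := ∑ x ∈ periodBox N, ∑ ν : Fin 4, nhsNormSq (chartDir (ContinuousLinearMap.id ℝ (Matrix n n ℂ)) N (v : TDir 4 n N) x ν) with hS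
  have hS0 : 0 ≤ S := Finset.sum_nonneg fun x _ => Finset.sum_nonneg fun ν _ => nhsNormSq_nonneg _
  have hcS : 0 ≤ (Fintype.card n : ℝ) * S := by positivity
  -- every bond value is bounded by `√(card n · S)`
  have hb : ∀ (r : Fin 4 → Fin N) (κ : Fin 4), ‖(v : TDir 4 n N) r κ‖ ≤ Real.sqrt ((Fintype.card n : ℝ) * S) := by
    intro r κ
    have h1 : ‖(v : TDir 4 n N) r κ‖ ^ 2 ≤ (Fintype.card n : ℝ) * nhsNormSq ((v : TDir 4 n N) r κ) := opNorm_sq_le_card_mul_nhsNormSq _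
    have hterm : nhsNormSq ((v : TDir 4 n N) r κ) = nhsNormSq (chartDir (ContinuousLinearMap.id ℝ (Matrix n n ℂ)) N (v : TDir 4 n N) (boxVec N r) κ) := by
      simp only [chartDir, ContinuousLinearMap.coe_id', id, redN_boxVec]
    have h2 : nhsNormSq (chartDir (ContinuousLinearMap.id ℝ (Matrix n n ℂ)) N (v : TDir 4 n N) (boxVec N r) κ)
        ≤ ∑ ν : Fin 4, nhsNormSq (chartDir (ContinuousLinearMap.id ℝ (Matrix n n ℂ)) N (v : TDir 4 n N) (boxVec N r) ν) :=
      Finset.single_le_sum (f := fun ν => nhsNormSq (chartDir (ContinuousLinearMap.id ℝ (Matrix n n ℂ)) N (v : TDir 4 n N) (boxVec N r) ν))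
        (fun ν _ => nhsNormSq_nonneg _) (Finset.mem_univ κ)
    have h3 : ∑ ν : Fin 4, nhsNormSq (chartDir (ContinuousLinearMap.id ℝ (Matrix n n ℂ)) N (v : TDir 4 n N) (boxVec N r) ν) ≤ S :=
      Finset.single_le_sum (f := fun x => ∑ ν : Fin 4, nhsNormSq (chartDir (ContinuousLinearMap.id ℝ (Matrix n n ℂ)) N (v : TDir 4 n N) x ν))
        (fun x _ => Finset.sum_nonneg fun ν _ => nhsNormSq_nonneg _) (boxVec_mem_periodBox r)
    refine Real.le_sqrt_of_sq_le ?_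
    calc ‖(v : TDir 4 n N) r κ‖ ^ 2 ≤ (Fintype.card n : ℝ) * nhsNormSq ((v : TDir 4 n N) r κ) := h1
      _ ≤ (Fintype.card n : ℝ) * S := by
          refine mul_le_mul_of_nonneg_left ?_ (Nat.cast_nonneg _)
          rw [hterm]
          exact h2.trans h3
  have hv : ‖v‖ ≤ Real.sqrt ((Fintype.card n : ℝ) * S) := by
    rw [Submodule.coe_norm]
    refine (pi_norm_le_iff_of_nonneg (Real.sqrt_nonneg _)).mpr fun r => ?_
    exact (pi_norm_le_iff_of_nonneg (Real.sqrt_nonneg _)).mpr fun κ => hb r κ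
  calc ‖v‖ ^ 2 ≤ (Real.sqrt ((Fintype.card n : ℝ) * S)) ^ 2 := pow_le_pow_left₀ (norm_nonneg _) hv 2
    _ = (Fintype.card n : ℝ) * S := Real.sq_sqrt hcS

/-- **Continuity of the Hessian as a quadratic form** (through `iteratedFDeriv ℝ 2`, ✓ `ContDiffAt.continuousAt_iteratedFDeriv`): if `M` is `C²` at `0` then for every `η > 0`, eventually in `y`,
`|D²M(y)[v,v] − D²M(0)[v,v]| ≤ η·‖v‖²` for all `v`. [folklore] -/
theorem hessian_quadratic_near {E : Type*} [NormedAddCommGroup E] [NormedSpace ℝ E] {M : E → ℝ} (hC2 : ContDiffAt ℝ 2 M 0) {η : ℝ} (hη : 0 < η) :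
    ∀ᶠ y in 𝓝 (0 : E), ∀ v : E, |fderiv ℝ (fderiv ℝ M) y v v - fderiv ℝ (fderiv ℝ M) 0 v v| ≤ η * ‖v‖ ^ 2 := by
  have hcont : ContinuousAt (iteratedFDeriv ℝ 2 M) 0 := hC2.continuousAt_iteratedFDeriv (k := 2) le_rfl
  have h := Metric.tendsto_nhds.mp hcont η hη
  filter_upwards [h] with y hy
  intro v
  rw [dist_eq_norm] at hy
  have e1 : fderiv ℝ (fderiv ℝ M) y v v = iteratedFDeriv ℝ 2 M y ![v, v] := by rw [iteratedFDeriv_two_apply]; rfl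
  have e0 : fderiv ℝ (fderiv ℝ M) 0 v v = iteratedFDeriv ℝ 2 M 0 ![v, v] := by rw [iteratedFDeriv_two_apply]; rfl
  have h1 := (iteratedFDeriv ℝ 2 M y - iteratedFDeriv ℝ 2 M 0).le_opNorm ![v, v]
  have h2 : (iteratedFDeriv ℝ 2 M y - iteratedFDeriv ℝ 2 M 0) ![v, v] = iteratedFDeriv ℝ 2 M y ![v, v] - iteratedFDeriv ℝ 2 M 0 ![v, v] := rfl
  rw [h2, Real.norm_eq_abs, Fin.prod_univ_two] at h1
  simp only [Matrix.cons_val_zero, Matrix.cons_val_one] at h1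
  rw [e1, e0]
  calc |iteratedFDeriv ℝ 2 M y ![v, v] - iteratedFDeriv ℝ 2 M 0 ![v, v]|
      ≤ ‖iteratedFDeriv ℝ 2 M y - iteratedFDeriv ℝ 2 M 0‖ * (‖v‖ * ‖v‖) := h1
    _ ≤ η * (‖v‖ * ‖v‖) := by gcongr
    _ = η * ‖v‖ ^ 2 := by ring

/-- **THE GAUGE-FIXED HESSIAN IS POSITIVE DEFINITE ON MEAN-ZERO DIRECTIONS IN A NEIGHBOURHOOD OF THE FLAT DATUM, EVERY LEVEL** (`d = 4`, every `U(n)`, `L ≥ 2`): for `0 < ε ≤ ε₀`,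
every `m` (`N = m+1`) and every `j`, for all data parameters `y` in a neighbourhood of `0` and every `v ∈ skewSub 4 n N` whose periodic extension has zero box mean,
`Σ_{x∈[0,N)^4} Σ_ν nhsNormSq (ṽ(x)_ν) ≤ m(m+1) · (D²(minAct 4 (sfClass 4 L N ε) L N (j+1) ∘ chart_1)(y)[v, v] + Σ_x nhsNormSq (Σ_μ (ṽ(x)_μ − ṽ(x−e_μ)_μ)))`. [folklore] -/
theorem gaugeFixed_hessian_gap_near_flat_allLevels [Nonempty n] {L : ℕ} [NeZero L] (hL : 2 ≤ L) :
    ∃ ε₀ : ℝ, 0 < ε₀ ∧ ∀ ε : ℝ, 0 < ε → ε ≤ ε₀ → ∀ (m j : ℕ),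
      ∀ᶠ y in 𝓝 (0 : ↥(skewSub 4 n (m + 1))), ∀ v : ↥(skewSub 4 n (m + 1)),
        (∀ ν : Fin 4, ∑ z ∈ periodBox (m + 1), chartDir (ContinuousLinearMap.id ℝ (Matrix n n ℂ)) (m + 1) (v : TDir 4 n (m + 1)) z ν = 0) →
        ∑ x ∈ periodBox (m + 1), ∑ ν : Fin 4, nhsNormSq (chartDir (ContinuousLinearMap.id ℝ (Matrix n n ℂ)) (m + 1) (v : TDir 4 n (m + 1)) x ν)
          ≤ (m : ℝ) * (m + 1) *
            (fderiv ℝ (fderiv ℝ (fun y' : ↥(skewSub 4 n (m + 1)) => minAct 4 (sfClass 4 L (m + 1) ε) L (m + 1) (j + 1)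
                (chart (ContinuousLinearMap.id ℝ (Matrix n n ℂ)) (m + 1) (flatCfg : Site 4 → Fin 4 → (Matrix n n ℂ)ˣ) (y' : TDir 4 n (m + 1))))) y v v
              + ∑ x ∈ periodBox (m + 1), nhsNormSq (∑ μ : Fin 4,
                  (chartDir (ContinuousLinearMap.id ℝ (Matrix n n ℂ)) (m + 1) (v : TDir 4 n (m + 1)) x μ
                    - chartDir (ContinuousLinearMap.id ℝ (Matrix n n ℂ)) (m + 1) (v : TDir 4 n (m + 1)) (x - e μ) μ))) := by
  obtain ⟨ε₁, hε₁, H₁⟩ := effectiveForm_add_divSq_ge_meanZero_flat_allLevels (n := n) hL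
  obtain ⟨ε₂, hε₂, H₂⟩ := minAct_hessian_flat_curl (n := n) hL
  refine ⟨min ε₁ ε₂, lt_min hε₁ hε₂, fun ε hε hεle m j => ?_⟩
  set M : ↥(skewSub 4 n (m + 1)) → ℝ := fun y' => minAct 4 (sfClass 4 L (m + 1) ε) L (m + 1) (j + 1)
    (chart (ContinuousLinearMap.id ℝ (Matrix n n ℂ)) (m + 1) (flatCfg : Site 4 → Fin 4 → (Matrix n n ℂ)ˣ) (y' : TDir 4 n (m + 1))) with hM
  -- the Hessian is `C²`-continuous at the flat datum
  have hC2 : ContDiffAt ℝ 2 M 0 := (H₂ ε hε (hεle.trans (min_le_right _ _)) (m + 1) (Nat.succ_pos m) j).1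
  -- the continuity margin
  set A : ℝ := (m : ℝ) * (m + 1) / 2 with hA
  have hA0 : 0 ≤ A := by positivity
  set Q : ℝ := 2 * A * (Fintype.card n : ℝ) with hQ
  have hQ0 : 0 ≤ Q := by positivity
  set η : ℝ := 1 / (Q + 1) with hη
  have hη0 : 0 < η := by rw [hη]; positivity
  have hη2 : A * η * (Fintype.card n : ℝ) ≤ 1 / 2 := by
    have e1 : A * η * (Fintype.card n : ℝ) = (A * (Fintype.card n : ℝ)) / (Q + 1) := by rw [hη]; ring
    rw [e1, div_le_iff₀ (by positivity : (0 : ℝ) < Q + 1), hQ]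
    linarith
  filter_upwards [hessian_quadratic_near hC2 hη0] with y hy
  intro v hmean
  -- the flat gap on mean-zero directions
  have h0 := H₁ ε hε (hεle.trans (min_le_left _ _)) m j v
  simp only [hmean, smul_zero, sub_zero] at h0
  set S : ℝ := ∑ x ∈ periodBox (m + 1), ∑ ν : Fin 4, nhsNormSq (chartDir (ContinuousLinearMap.id ℝ (Matrix n n ℂ)) (m + 1) (v : TDir 4 n (m + 1)) x ν) with hS
  set D : ℝ := ∑ x ∈ periodBox (m + 1), nhsNormSq (∑ μ : Fin 4,
      (chartDir (ContinuousLinearMap.id ℝ (Matrix n n ℂ)) (m + 1) (v : TDir 4 n (m + 1)) x μ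
        - chartDir (ContinuousLinearMap.id ℝ (Matrix n n ℂ)) (m + 1) (v : TDir 4 n (m + 1)) (x - e μ) μ)) with hD
  have hS0 : 0 ≤ S := Finset.sum_nonneg fun x _ => Finset.sum_nonneg fun ν _ => nhsNormSq_nonneg _
  -- continuity of the quadratic form
  have hdiff : fderiv ℝ (fderiv ℝ M) 0 v v ≤ fderiv ℝ (fderiv ℝ M) y v v + η * ‖v‖ ^ 2 := by
    have h3 := (abs_le.mp (hy v)).1
    linarith
  have hnorm : ‖v‖ ^ 2 ≤ (Fintype.card n : ℝ) * S := norm_sq_le_card_mul_sum_nhsNormSq v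
  -- assemble: S ≤ A(X₀ + D) ≤ A(X + D) + AηC·S ≤ A(X + D) + S/2
  have h4 : A * (η * ‖v‖ ^ 2) ≤ A * (η * ((Fintype.card n : ℝ) * S)) :=
    mul_le_mul_of_nonneg_left (mul_le_mul_of_nonneg_left hnorm hη0.le) hA0
  have h5 : A * (η * ((Fintype.card n : ℝ) * S)) ≤ 1 / 2 * S := by
    have := mul_le_mul_of_nonneg_right hη2 hS0
    linarith [this]
  have h6 : S ≤ A * (fderiv ℝ (fderiv ℝ M) 0 v v + D) := h0
  have h7 : A * (fderiv ℝ (fderiv ℝ M) 0 v v + D) ≤ A * (fderiv ℝ (fderiv ℝ M) y v v + η * ‖v‖ ^ 2 + D) :=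
    mul_le_mul_of_nonneg_left (by linarith) hA0
  have h8 : S ≤ 2 * A * (fderiv ℝ (fderiv ℝ M) y v v + D) := by nlinarith
  have h9 : 2 * A = (m : ℝ) * (m + 1) := by rw [hA]; ring
  rw [h9] at h8
  exact h8

end

end Summit.QuantumFields.BalabanUV.T4Continuum.NE7GaugeFixedHessianNearFlat
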